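import Mathlib
import Summits.AtomisticToContinuum.Crystallization.Theses.PhononSlackCertificates
import Literature.MathematicalPhysics.StatisticalMechanics.LennardJonesClusters
import Literature.Geometry.DiscreteGeometry.TwoShellPatterns
import Summits.AtomisticToContinuum.Crystallization.Theorems.PhononSlackCertificatesNearFarGlueRGlue

/-!
# Stub `stub_glueTight` of line `Sketch` for the crux `PhononSlackCertificates.NearFarGlueR`
(item stmt-AtomisticToContinuum-14970, route route-AtomisticToContinuum-PhononSlackCertificates)

The bookkeeping step of the line with the TIGHT contact radius `21/20`.  GIVEN, as hypotheses,
* the tight descent lemma `hD` (for a `1/20`-good particle `i` and ANY particle `j ≠ i`, some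
  particle `k ≠ i` within `21/20` of `x i` is strictly closer to `x j`),
* the fibre / packing count `hFib` (if every point of `S` is within `R` of `T` then
  `#S ≤ (2R/δ+1)³ · #T` in a `δ`-separated configuration),
* the tight contact gap `hCG` (`N·e* + g₂ · #{bad particles within 21/20 of a good one} ≤ 𝓔_LJ`),
the route implication `FarFieldGapR → NearFieldConvexity → CoerciveTwoShellGap` holds.

Proof.  Identical to the landed radius-`3` bookkeeping
(`Theorems.PhononSlackCertificatesNearFarGlueRGlue.stub_glue`, whose arithmetic and energy helpers
are reused by name), with the contact predicate `dist (x i) (x j) ≤ 3` replaced by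
`dist (x i) (x j) ≤ 21/20` and the key lemma replaced by `glueTight_exists_contact_near`:
minimise the distance from the bad particle `j` over the (nonempty) set of good particles; the
minimiser `i` is good, so `j ≠ i`, and the tight descent lemma yields `k ≠ i` within `21/20` of
`x i` strictly closer to `x j`; by minimality `k` is bad, hence a TIGHT contact particle, and it is
no farther from `j` than `i`, hence within `ρ` of `j` whenever some good particle is.
Fix `δ > 0`; take `(g_F, C_F, R_F)` from `FarFieldGapR`, `(c, C_N)` from `NearFieldConvexity` at
`η = 1`, and `g₂` from the tight contact gap; put `R' = max R_F 0`, `K₁ = (2R'/δ+1)³`,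
`K₂ = (16/δ+1)³`, `M = C_F⁺ K₁ + C_N⁺ K₂ ≥ 0` and `g = g_F g₂ / (g₂ + M) > 0`.  For a
`δ`-separated `x` let `B` = bad particles, `G` = good particles, `T` = tight contact particles.
The far field on `U = B` and the near field on `Ω = G` give, after dropping the nonnegative
`c`-term and adding (`Σ_B + Σ_G = 𝓔 − N e*`, double counting),
`g_F #B − C_F #∂_{R_F} B − C_N #∂₄ G ≤ 𝓔 − N e*`; every point of `∂_{R_F} B` is within `R'` of
`T`, every point of `∂₄ G` is within `8` of `T`, so the fibre count bounds the two boundary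
cardinalities by `K₁ #T` and `K₂ #T`; with `g₂ #T ≤ 𝓔 − N e*` the convex combination with weight
`g₂/(g₂+M)` gives `g #B ≤ 𝓔 − N e*`, which is `CoerciveTwoShellGap`.
-/

noncomputable section

namespace Summit.AtomisticToContinuum.Crystallization.Theorems.PhononSlackCertificatesNearFarGlueR

open Literature.MathematicalPhysics.StatisticalMechanics
open Literature.Geometry.DiscreteGeometry
open Summit.AtomisticToContinuum.Crystallization.Theses.PhononSlackCertificates
open scoped BigOperators RealInnerProductSpace

/-! ## The key lemma: a tight contact particle near every bad particle that sees a good one -/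

/-- **Tight contact near every bad particle that sees a good one.**  If the bad particle `j` has
a good particle within `ρ`, then some TIGHT CONTACT particle (bad, with a good particle within
`21/20`) lies within `ρ` of `j`: minimise the distance from `j` over the good particles; the
minimiser `i` is good, hence `j ≠ i`, and the tight descent lemma produces a particle `k ≠ i`
within `21/20` of `x i` strictly closer to `x j`, which by minimality is bad, hence a tight contact
particle (witness `i`), and is no farther from `j` than `i`. [folklore] -/
theorem glueTight_exists_contact_near
    (hD : ∀ (N : ℕ) (x : Fin N → EuclideanSpace ℝ (Fin 3)) (i j : Fin N),
      IsTwoShellGood (1 / 20) (47 / 50) 1 x i → j ≠ i →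
      ∃ k : Fin N, k ≠ i ∧ dist (x k) (x i) ≤ 21 / 20 ∧ dist (x j) (x k) < dist (x j) (x i))
    {N : ℕ} (x : Fin N → EuclideanSpace ℝ (Fin 3)) {j i₀ : Fin N} {ρ : ℝ}
    (hj : ¬ IsTwoShellGood (1 / 20) (47 / 50) 1 x j)
    (hi₀ : IsTwoShellGood (1 / 20) (47 / 50) 1 x i₀) (hρ : dist (x i₀) (x j) ≤ ρ) :
    ∃ k : Fin N, (¬ IsTwoShellGood (1 / 20) (47 / 50) 1 x k ∧
      ∃ i : Fin N, IsTwoShellGood (1 / 20) (47 / 50) 1 x i ∧ dist (x i) (x k) ≤ 21 / 20) ∧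
      dist (x j) (x k) ≤ ρ := by
  classical
  obtain ⟨i, hi, hmin⟩ :=
    (Finset.univ.filter fun i => IsTwoShellGood (1 / 20) (47 / 50) 1 x i).exists_min_image
      (fun i => dist (x j) (x i)) ⟨i₀, (Finset.mem_filter_univ i₀).2 hi₀⟩
  have hiG : IsTwoShellGood (1 / 20) (47 / 50) 1 x i := (Finset.mem_filter_univ i).1 hi
  have hi₀' : dist (x j) (x i) ≤ ρ :=
    (hmin i₀ ((Finset.mem_filter_univ i₀).2 hi₀)).trans ((dist_comm (x j) (x i₀)).trans_le hρ)
  have hji : j ≠ i := by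
    rintro rfl
    exact hj hiG
  obtain ⟨k, -, hki, hjk⟩ := hD N x i j hiG hji
  have hkbad : ¬ IsTwoShellGood (1 / 20) (47 / 50) 1 x k := fun hk =>
    absurd (hmin k ((Finset.mem_filter_univ k).2 hk)) (not_le.2 hjk)
  exact ⟨k, ⟨hkbad, i, hiG, (dist_comm (x i) (x k)).trans_le hki⟩, hjk.le.trans hi₀'⟩

/-! ## The registered stub -/

/-- **STUB `stub_glueTight` (line `Sketch`, crux `NearFarGlueR`)**: the bookkeeping with the tight
contact radius `21/20` — far field on `U :=` all bad particles, near field (`η = 1`) on `Ω :=` all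
good particles, both boundary counts dominated by the tight contact count (tight descent `hD` +
fibre `hFib` through `glueTight_exists_contact_near`), and a convex combination with the tight
contact gap `hCG`. [folklore] -/
theorem stub_glueTight :
    (∀ (N : ℕ) (x : Fin N → EuclideanSpace ℝ (Fin 3)) (i j : Fin N),
      IsTwoShellGood (1 / 20) (47 / 50) 1 x i → j ≠ i →
      ∃ k : Fin N, k ≠ i ∧ dist (x k) (x i) ≤ 21 / 20 ∧ dist (x j) (x k) < dist (x j) (x i)) →
    (∀ (δ R : ℝ), 0 < δ → 0 ≤ R → ∀ (N : ℕ) (x : Fin N → EuclideanSpace ℝ (Fin 3)),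
      (∀ i j : Fin N, i ≠ j → δ ≤ dist (x i) (x j)) →
      ∀ S T : Finset (Fin N), (∀ j ∈ S, ∃ k ∈ T, dist (x j) (x k) ≤ R) →
        (S.card : ℝ) ≤ (2 * R / δ + 1) ^ 3 * (T.card : ℝ)) →
    (∀ δ : ℝ, 0 < δ → ∃ g₂ : ℝ, 0 < g₂ ∧ ∀ (N : ℕ) (x : Fin N → EuclideanSpace ℝ (Fin 3)),
      (∀ i j : Fin N, i ≠ j → δ ≤ dist (x i) (x j)) →
      (N : ℝ) * (⨅ Q : PeriodicConfiguration 3, Q.energyPerParticle lennardJones)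
        + g₂ * (Nat.card {j : Fin N // ¬ IsTwoShellGood (1 / 20) (47 / 50) 1 x j ∧
            ∃ i : Fin N, IsTwoShellGood (1 / 20) (47 / 50) 1 x i ∧ dist (x i) (x j) ≤ 21 / 20} : ℝ)
        ≤ interactionEnergy lennardJones x) →
    FarFieldGapR → NearFieldConvexity → CoerciveTwoShellGap := by
  intro hD hFib hCG hFF hNF δ hδ
  obtain ⟨gF, hgF, CF, RF, hfar⟩ := hFF δ hδ
  obtain ⟨c, hc, CN, hnear⟩ := hNF δ hδ 1 one_pos
  obtain ⟨g₂, hg₂, hcontact⟩ := hCG δ hδ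
  -- the constants (kept opaque)
  obtain ⟨R', hRF, hR'⟩ : ∃ R' : ℝ, RF ≤ R' ∧ 0 ≤ R' :=
    ⟨max RF 0, le_max_left _ _, le_max_right _ _⟩
  obtain ⟨K₁, hK₁, hK₁0⟩ : ∃ K : ℝ, K = (2 * R' / δ + 1) ^ 3 ∧ 0 ≤ K :=
    ⟨_, rfl, pow_nonneg (add_nonneg (div_nonneg (mul_nonneg zero_le_two hR') hδ.le)
      zero_le_one) 3⟩
  obtain ⟨K₂, hK₂, hK₂0⟩ : ∃ K : ℝ, K = (2 * 8 / δ + 1) ^ 3 ∧ 0 ≤ K :=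
    ⟨_, rfl, pow_nonneg (add_nonneg (div_nonneg (by norm_num) hδ.le) zero_le_one) 3⟩
  obtain ⟨M, hM, hM0⟩ : ∃ M : ℝ, M = max CF 0 * K₁ + max CN 0 * K₂ ∧ 0 ≤ M :=
    ⟨_, rfl, add_nonneg (mul_nonneg (le_max_right _ _) hK₁0) (mul_nonneg (le_max_right _ _) hK₂0)⟩
  refine ⟨gF * g₂ / (g₂ + M), div_pos (mul_pos hgF hg₂) (add_pos_of_pos_of_nonneg hg₂ hM0),
    fun N x hsep => ?_⟩
  classical
  -- the three populations: bad `B`, good `G`, tight contact `T`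
  obtain ⟨B, hB⟩ : ∃ B : Finset (Fin N),
      B = Finset.univ.filter fun i => ¬ IsTwoShellGood (1 / 20) (47 / 50) 1 x i := ⟨_, rfl⟩
  obtain ⟨G, hG⟩ : ∃ G : Finset (Fin N),
      G = Finset.univ.filter fun i => IsTwoShellGood (1 / 20) (47 / 50) 1 x i := ⟨_, rfl⟩
  obtain ⟨T, hT⟩ : ∃ T : Finset (Fin N),
      T = Finset.univ.filter fun j => ¬ IsTwoShellGood (1 / 20) (47 / 50) 1 x j ∧
        ∃ i : Fin N, IsTwoShellGood (1 / 20) (47 / 50) 1 x i ∧ dist (x i) (x j) ≤ 21 / 20 :=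
    ⟨_, rfl⟩
  have hmemB : ∀ i, i ∈ B ↔ ¬ IsTwoShellGood (1 / 20) (47 / 50) 1 x i := fun i => by
    rw [hB]; exact Finset.mem_filter_univ i
  have hmemG : ∀ i, i ∈ G ↔ IsTwoShellGood (1 / 20) (47 / 50) 1 x i := fun i => by
    rw [hG]; exact Finset.mem_filter_univ i
  have hmemT : ∀ j, j ∈ T ↔ (¬ IsTwoShellGood (1 / 20) (47 / 50) 1 x j ∧
      ∃ i : Fin N, IsTwoShellGood (1 / 20) (47 / 50) 1 x i ∧ dist (x i) (x j) ≤ 21 / 20) :=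
    fun j => by rw [hT]; exact Finset.mem_filter_univ j
  -- the two boundary layers charged by the antecedents
  obtain ⟨SB, hSB⟩ : ∃ SB : Finset (Fin N),
      SB = Finset.univ.filter fun i => i ∈ B ∧ ∃ j : Fin N, j ∉ B ∧ dist (x j) (x i) ≤ RF :=
    ⟨_, rfl⟩
  obtain ⟨SG, hSG⟩ : ∃ SG : Finset (Fin N),
      SG = Finset.univ.filter fun i => i ∈ G ∧ ∃ j : Fin N, j ∉ G ∧ dist (x j) (x i) ≤ 4 :=
    ⟨_, rfl⟩
  have hmemSB : ∀ i, i ∈ SB ↔ (i ∈ B ∧ ∃ j : Fin N, j ∉ B ∧ dist (x j) (x i) ≤ RF) :=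
    fun i => by rw [hSB]; exact Finset.mem_filter_univ i
  have hmemSG : ∀ i, i ∈ SG ↔ (i ∈ G ∧ ∃ j : Fin N, j ∉ G ∧ dist (x j) (x i) ≤ 4) :=
    fun i => by rw [hSG]; exact Finset.mem_filter_univ i
  -- the four cardinalities as finset cards
  have hcardB : Nat.card {i : Fin N // ¬ IsTwoShellGood (1 / 20) (47 / 50) 1 x i} = B.card :=
    Nat.subtype_card B hmemB
  have hcardT : Nat.card {j : Fin N // ¬ IsTwoShellGood (1 / 20) (47 / 50) 1 x j ∧
      ∃ i : Fin N, IsTwoShellGood (1 / 20) (47 / 50) 1 x i ∧ dist (x i) (x j) ≤ 21 / 20}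
        = T.card :=
    Nat.subtype_card T hmemT
  have hcardSB :
      Nat.card {i : Fin N // i ∈ B ∧ ∃ j : Fin N, j ∉ B ∧ dist (x j) (x i) ≤ RF} = SB.card :=
    Nat.subtype_card SB hmemSB
  have hcardSG :
      Nat.card {i : Fin N // i ∈ G ∧ ∃ j : Fin N, j ∉ G ∧ dist (x j) (x i) ≤ 4} = SG.card :=
    Nat.subtype_card SG hmemSG
  -- (C1) the `R_F`-boundary of `B` lies within `R'` of the tight contact set
  have hC1 : ∀ i ∈ SB, ∃ k ∈ T, dist (x i) (x k) ≤ R' := by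
    intro i hi
    obtain ⟨hiB, j, hjB, hji⟩ := (hmemSB i).1 hi
    have hibad : ¬ IsTwoShellGood (1 / 20) (47 / 50) 1 x i := (hmemB i).1 hiB
    have hjgood : IsTwoShellGood (1 / 20) (47 / 50) 1 x j := not_not.1 (mt (hmemB j).2 hjB)
    obtain ⟨k, hk, hik⟩ := glueTight_exists_contact_near hD x hibad hjgood (hji.trans hRF)
    exact ⟨k, (hmemT k).2 hk, hik⟩
  -- (C2) the `4`-boundary of `G` lies within `8` of the tight contact set
  have hC2 : ∀ i ∈ SG, ∃ k ∈ T, dist (x i) (x k) ≤ 8 := by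
    intro i hi
    obtain ⟨hiG, j, hjG, hji⟩ := (hmemSG i).1 hi
    have higood : IsTwoShellGood (1 / 20) (47 / 50) 1 x i := (hmemG i).1 hiG
    have hjbad : ¬ IsTwoShellGood (1 / 20) (47 / 50) 1 x j := mt (hmemG j).2 hjG
    have hij : dist (x i) (x j) ≤ 4 := (dist_comm (x i) (x j)).trans_le hji
    obtain ⟨k, hk, hjk⟩ := glueTight_exists_contact_near hD x hjbad higood hij
    refine ⟨k, (hmemT k).2 hk, ?_⟩
    calc dist (x i) (x k) ≤ dist (x i) (x j) + dist (x j) (x k) := dist_triangle _ _ _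
      _ ≤ 4 + 4 := add_le_add hij hjk
      _ = 8 := by norm_num
  -- fibre counts of the two boundary layers over the tight contact set
  have hFib1 : (SB.card : ℝ) ≤ K₁ * (T.card : ℝ) := by
    rw [hK₁]; exact hFib δ R' hδ hR' N x hsep SB T hC1
  have hFib2 : (SG.card : ℝ) ≤ K₂ * (T.card : ℝ) := by
    rw [hK₂]; exact hFib δ 8 hδ (by norm_num) N x hsep SG T hC2
  -- the antecedents on `U := B`, `Ω := G`, and the tight contact gap
  have hF := hfar N x hsep B (fun i hi => (hmemB i).1 hi)
  have hN := hnear N x hsep G (fun i hi => (hmemG i).1 hi)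
  have h2 := hcontact N x hsep
  rw [hcardSB] at hF
  rw [hcardSG] at hN
  rw [hcardT] at h2
  rw [hcardB]
  -- the energy identity `Σ_B + Σ_G = 𝓔 − N e*`
  have hE : (∑ i ∈ B, ((1 / 2 : ℝ) * (∑ j ∈ Finset.univ.erase i, lennardJones (dist (x i) (x j)))
        - (⨅ Q : PeriodicConfiguration 3, Q.energyPerParticle lennardJones)))
      + ∑ i ∈ G, ((1 / 2 : ℝ) * (∑ j ∈ Finset.univ.erase i, lennardJones (dist (x i) (x j)))
        - (⨅ Q : PeriodicConfiguration 3, Q.energyPerParticle lennardJones))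
      = interactionEnergy lennardJones x
        - N * (⨅ Q : PeriodicConfiguration 3, Q.energyPerParticle lennardJones) := by
    rw [← glue_sum_univ_half_site_sub x, hB, hG]
    exact Finset.sum_filter_not_add_sum_filter _ _ _
  -- bookkeeping
  have hN' := glue_drop_nonneg hN hc.le (Nat.cast_nonneg _)
  have hcf := glue_charge_bound (C := CF) (Nat.cast_nonneg SB.card) hFib1
  have hcn := glue_charge_bound (C := CN) (Nat.cast_nonneg SG.card) hFib2
  have hMt : M * (T.card : ℝ)
      = max CF 0 * (K₁ * (T.card : ℝ)) + max CN 0 * (K₂ * (T.card : ℝ)) := by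
    rw [hM]; ring
  have h1 : gF * (B.card : ℝ) - M * (T.card : ℝ) ≤ interactionEnergy lennardJones x
      - N * (⨅ Q : PeriodicConfiguration 3, Q.energyPerParticle lennardJones) := by
    linarith
  have key := glue_levy_arith hg₂ hM0 h1 (by linarith)
  linarith

end Summit.AtomisticToContinuum.Crystallization.Theorems.PhononSlackCertificatesNearFarGlueR

end
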